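import Literature.Analysis.FluidPDE.DuchonRobertMollifierKernel
import Literature.Analysis.FluidPDE.OnsagerCCFSTestField
import Literature.Analysis.FluidPDE.PassiveScalarProofs
import Literature.Analysis.FunctionSpaces.TorusApproximateIdentity
import Literature.Analysis.FunctionSpaces.TorusMollifierEstimates
import Literature.Analysis.FunctionSpaces.TorusFourierModes
import HarnessLib

/-!
# Duchon–Robert's local energy balance: discharge of the pressure limit

Proof file for `Literature.Analysis.FluidPDE.DuchonRobertLocalBalance`. It discharges the named
fact `Torus.tendsto_pressure_pairing` (Duchon–Robert 2000, proof of Prop. 1, p. 251, the step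
`div(½(u p^ε + u^ε p)) → div(u p)`, quoted from Evans, *Partial Differential Equations*,
App. C.4, Thm. 7 (iv): `f^ε → f` in `L^p_{loc}`, `1 ≤ p < ∞`):

* the "approximate identity along `ε → 0⁺`" package of the torus kernels
  `K_ε = mollifierKernel φ ε` of a Euclidean mollifier `φ` (`Torus.eventually_mollifierKernel`,
  `Torus.eventually_support_mollifierKernel_subset`, from `Torus.support_mollifierKernel_subset` of
  `DuchonRobertMollifierKernel`);
* `Torus.divergence_symmTestField` (**proved**): for an integrable, weakly divergence-free `v`,
  a smooth kernel `K` and a smooth cut-off `χ`, the symmetric Duchon–Robert field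
  `Φ = χ (v ⋆ K) + (χ v) ⋆ K` has `div Φ = ⟪v ⋆ K, ∇χ⟫ + ⟪v, ∇χ⟫ ⋆ K` (Leibniz rule,
  `∂ᵢ(θ ⋆ K) = θ ⋆ ∂ᵢK`, and weak divergence-freeness tested against the smooth functions
  `K(x - ·)` and `χ K(x - ·)`);
* `Torus.tendsto_pressure_pairing_holds` (**proved**): `∫₀ᵀ∫ p div Φ_ε → 2 ∫₀ᵀ∫ p ⟪u, ∇ψ⟫`
  as `ε → 0⁺`, for `u ∈ L³_{t,x}` weakly divergence free, `p ∈ L^{3/2}_{t,x}`: by the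
  divergence formula the pairing is `∑ᵢ ∫∫ p ∂ᵢψ (uᵢ ⋆ K_ε) + ∫∫ p (⟪u, ∇ψ⟫ ⋆ K_ε)`, and
  `uᵢ ⋆ K_ε → uᵢ`, `⟪u, ∇ψ⟫ ⋆ K_ε → ⟪u, ∇ψ⟫` in `L³((0,T) × T^d)`
  (`Torus.tendsto_lintegral_prod_rpow_enorm_convolution_sub_self`, `TorusApproximateIdentity`)
  against the `L^{3/2}` weights `p ∂ᵢψ`, `p` (Hölder `3/2, 3`).

## References

* J. Duchon, R. Robert, *Inertial energy dissipation for weak solutions of incompressible Euler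
  and Navier–Stokes equations*, Nonlinearity 13 (2000) 249–255, proof of Prop. 1, pp. 250–251.
  [DuchonRobert2000]
* L. C. Evans, *Partial Differential Equations*, 2nd ed. (AMS 2010), App. C.4, Thm. 7 (iv).
  [Evans2010]
-/

noncomputable section

open MeasureTheory TopologicalSpace Set Function Filter Topology Metric
open scoped ENNReal NNReal Convolution ContDiff InnerProductSpace RealInnerProductSpace

namespace Literature.Analysis.FluidPDE.Torus

variable {d : Type*} [Fintype d] [DecidableEq d]

/-! ## The torus kernels of a mollifier form an approximate identity along `ε → 0⁺` -/

section Kernel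

variable {φ : EuclideanSpace ℝ d → ℝ}

/-- Along `ε → 0⁺` the torus kernels of a mollifier are nonnegative, of unit mass and
continuous. [folklore] -/
theorem eventually_mollifierKernel (hφ : FluidPDE.IsMollifier φ) :
    ∀ᶠ ε in 𝓝[>] (0 : ℝ), (∀ z, 0 ≤ mollifierKernel φ ε z) ∧
      ∫ z, mollifierKernel φ ε z = 1 ∧ Continuous (mollifierKernel φ ε) := by
  filter_upwards [self_mem_nhdsWithin] with ε hε
  exact ⟨mollifierKernel_nonneg hφ (le_of_lt hε), integral_mollifierKernel hφ hε,
    continuous_mollifierKernel hφ hε⟩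

/-- Along `ε → 0⁺` the supports of the torus kernels of a mollifier eventually lie in any ball
`B(0, δ)`, `δ > 0`. [folklore] -/
theorem eventually_support_mollifierKernel_subset (hφ : FluidPDE.IsMollifier φ) {δ : ℝ}
    (hδ : 0 < δ) : ∀ᶠ ε in 𝓝[>] (0 : ℝ), support (mollifierKernel φ ε) ⊆ ball 0 δ := by
  obtain ⟨R, hR⟩ := hφ.2.1.exists_tsupport_subset_closedBall
  have hR1 : 0 < |R| + 1 := by positivity
  filter_upwards [Ioo_mem_nhdsGT (div_pos hδ hR1)] with ε hε
  refine (support_mollifierKernel_subset hR hε.1).trans (ball_subset_ball ?_)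
  calc ε * (R + 1) ≤ ε * (|R| + 1) := by nlinarith [hε.1, le_abs_self R]
    _ ≤ δ / (|R| + 1) * (|R| + 1) := (mul_le_mul_of_nonneg_right hε.2.le hR1.le)
    _ = δ := div_mul_cancel₀ δ hR1.ne'

end Kernel

/-! ## The divergence of the symmetric Duchon–Robert field -/

section Divergence

variable {K : UnitAddTorus d → ℝ} {χ : UnitAddTorus d → ℝ} {v : UnitAddTorus d → EuclideanSpace ℝ d}

/-- **The commuted cut-off**: `∑ᵢ ((χ vᵢ) ⋆ ∂ᵢK)(x) = (⟪v, ∇χ⟫ ⋆ K)(x)` for an integrable, weakly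
divergence-free `v`, a smooth `K` and a smooth `χ` (test weak divergence-freeness with the smooth
function `y ↦ χ(y) K(x - y)`, whose gradient is `χ ∇(K(x - ·)) + K(x - ·) ∇χ`). [folklore] -/
theorem sum_convolution_mul_partialDeriv_eq (hK : FunctionSpaces.Torus.IsSmooth K)
    (hχ : FunctionSpaces.Torus.IsSmooth χ) (hv : Integrable v volume)
    (hdiv : FunctionSpaces.Torus.IsWeaklyDivFree v) (x : UnitAddTorus d) :
    ∑ i, ((fun y => χ y * v y i) ⋆ FunctionSpaces.Torus.partialDeriv i K) x =
      ((fun y => ⟪v y, FunctionSpaces.Torus.gradient χ y⟫) ⋆ K) x := by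
  have hK1 : FunctionSpaces.Torus.IsContDiff 1 K := hK.isContDiff (by simp)
  have hvi : ∀ i, Integrable (fun y => v y i) volume := fun i =>
    (EuclideanSpace.proj (𝕜 := ℝ) i).integrable_comp hv
  have hχvi : ∀ i, Integrable (fun y => χ y * v y i) volume := fun i => hχ.integrable_smul (hvi i)
  have hint : ∀ i, Integrable
      (fun y => (χ y * v y i) • FunctionSpaces.Torus.partialDeriv i K (x - y)) volume :=
    fun i => FunctionSpaces.Torus.integrable_smul_comp_sub (hχvi i) (hK.partialDeriv i).continuous x
  simp only [convolution_lsmul]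
  rw [← integral_finsetSum _ fun i _ => hint i]
  -- the smooth test function `θ = χ K(x - ·)` and its gradient
  have hKx : FunctionSpaces.Torus.IsSmooth (fun y => K (x - y)) := hK.comp_sub_left x
  have hθ : FunctionSpaces.Torus.IsSmooth (fun y => χ y * K (x - y)) := ContDiff.mul hχ hKx
  have hgradθ : ∀ y, FunctionSpaces.Torus.gradient (fun y => χ y * K (x - y)) y =
      χ y • FunctionSpaces.Torus.gradient (fun y => K (x - y)) y +
        K (x - y) • FunctionSpaces.Torus.gradient χ y := fun y =>
    gradient_mul (hχ.isContDiff (by simp)) (hKx.isContDiff (by simp)) y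
  have h0 := hdiv _ hθ
  have hI1 : Integrable
      (fun y => ⟪v y, χ y • FunctionSpaces.Torus.gradient (fun y => K (x - y)) y⟫) volume :=
    FunctionSpaces.Torus.integrable_inner_of_continuous hv (hχ.continuous.smul hKx.gradient.continuous)
  have hI2 : Integrable (fun y => ⟪v y, K (x - y) • FunctionSpaces.Torus.gradient χ y⟫) volume :=
    FunctionSpaces.Torus.integrable_inner_of_continuous hv (hKx.continuous.smul hχ.gradient.continuous)
  have hsplit : ∫ y, ⟪v y, FunctionSpaces.Torus.gradient (fun y => χ y * K (x - y)) y⟫ =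
      (∫ y, ⟪v y, χ y • FunctionSpaces.Torus.gradient (fun y => K (x - y)) y⟫) +
        ∫ y, ⟪v y, K (x - y) • FunctionSpaces.Torus.gradient χ y⟫ := by
    rw [← integral_add hI1 hI2]
    refine integral_congr_ae (ae_of_all _ fun y => ?_)
    dsimp only
    rw [hgradθ, inner_add_right]
  have hkey : (∫ y, ⟪v y, χ y • FunctionSpaces.Torus.gradient (fun y => K (x - y)) y⟫) =
      -∫ y, ⟪v y, K (x - y) • FunctionSpaces.Torus.gradient χ y⟫ := by
    rw [hsplit] at h0
    linarith
  have hpt : ∀ y, ∑ i, (χ y * v y i) • FunctionSpaces.Torus.partialDeriv i K (x - y) =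
      -⟪v y, χ y • FunctionSpaces.Torus.gradient (fun y => K (x - y)) y⟫ := fun y => by
    rw [FunctionSpaces.Torus.gradient_comp_sub_left, smul_neg, inner_neg_right, neg_neg,
      real_inner_smul_right, PiLp.inner_apply, Finset.mul_sum]
    refine Finset.sum_congr rfl fun i _ => ?_
    rw [RCLike.inner_apply, conj_trivial, FunctionSpaces.Torus.gradient_apply hK1 (x - y) i,
      smul_eq_mul]
    ring
  simp_rw [hpt]
  rw [integral_neg, hkey, neg_neg]
  refine integral_congr_ae (ae_of_all _ fun y => ?_)
  dsimp only
  rw [real_inner_smul_right, smul_eq_mul, mul_comm]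

/-- **The divergence of the symmetric Duchon–Robert field.** For an integrable, weakly
divergence-free `v`, a smooth kernel `K` and a smooth cut-off `χ`, the field
`Φ = χ (v ⋆ K) + (χ v) ⋆ K` (`Torus.symmTestField`) has
`div Φ = ⟪v ⋆ K, ∇χ⟫ + ⟪v, ∇χ⟫ ⋆ K` (Duchon–Robert 2000, proof of Prop. 1, p. 251: the
pressure term `div(½(u p^ε + u^ε p))` only sees `∇` falling on the cut-off, `div u = 0`).
Proof: `∂ᵢΦᵢ = ∂ᵢχ (vᵢ ⋆ K) + χ (vᵢ ⋆ ∂ᵢK) + (χ vᵢ) ⋆ ∂ᵢK`; summed over `i`, the middle terms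
vanish (`sum_convolution_partialDeriv_eq_zero`, `OnsagerCCFSTestField`) and the last ones give `⟪v, ∇χ⟫ ⋆ K`
(`sum_convolution_mul_partialDeriv_eq`). [cite: DuchonRobert2000, proof of Prop. 1 p. 251] -/
theorem divergence_symmTestField (hK : FunctionSpaces.Torus.IsSmooth K)
    (hχ : FunctionSpaces.Torus.IsSmooth χ) (hv : Integrable v volume)
    (hdiv : FunctionSpaces.Torus.IsWeaklyDivFree v) (x : UnitAddTorus d) :
    FunctionSpaces.Torus.divergence (symmTestField K χ v) x =
      ⟪vecConv v K x, FunctionSpaces.Torus.gradient χ x⟫ +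
        ((fun y => ⟪v y, FunctionSpaces.Torus.gradient χ y⟫) ⋆ K) x := by
  have hχ1 : FunctionSpaces.Torus.IsContDiff 1 χ := hχ.isContDiff (by simp)
  have hvi : ∀ i, Integrable (fun y => v y i) volume := fun i =>
    (EuclideanSpace.proj (𝕜 := ℝ) i).integrable_comp hv
  have hχvi : ∀ i, Integrable (fun y => χ y * v y i) volume := fun i => hχ.integrable_smul (hvi i)
  -- the smooth pieces of the components
  have hA : ∀ i, FunctionSpaces.Torus.IsSmooth ((fun y => v y i) ⋆ K) := fun i =>
    FunctionSpaces.Torus.isSmooth_convolution (hvi i) hK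
  have hB : ∀ i, FunctionSpaces.Torus.IsSmooth ((fun y => χ y * v y i) ⋆ K) := fun i =>
    FunctionSpaces.Torus.isSmooth_convolution (hχvi i) hK
  have hA1 : ∀ i, FunctionSpaces.Torus.IsContDiff 1 (fun y => χ y * ((fun y => v y i) ⋆ K) y) :=
    fun i => ContDiff.mul hχ1 ((hA i).isContDiff (by simp))
  -- the components of the symmetric field
  have hcomp : ∀ i, (fun y => symmTestField K χ v y i) =
      (fun y => χ y * ((fun y => v y i) ⋆ K) y) + ((fun y => χ y * v y i) ⋆ K) := by
    intro i
    funext y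
    simp only [symmTestField_apply, PiLp.add_apply, PiLp.smul_apply, vecConv_apply, smul_eq_mul,
      Pi.add_apply]
  -- differentiate
  have hderiv : ∀ i, FunctionSpaces.Torus.partialDeriv i (fun y => symmTestField K χ v y i) x =
      FunctionSpaces.Torus.partialDeriv i χ x * ((fun y => v y i) ⋆ K) x +
        χ x * ((fun y => v y i) ⋆ FunctionSpaces.Torus.partialDeriv i K) x +
        ((fun y => χ y * v y i) ⋆ FunctionSpaces.Torus.partialDeriv i K) x := by
    intro i
    rw [hcomp i, FunctionSpaces.Torus.partialDeriv_add (hA1 i) ((hB i).isContDiff (by simp)),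
      Pi.add_apply, FunctionSpaces.Torus.partialDeriv_mul hχ1 ((hA i).isContDiff (by simp)),
      FunctionSpaces.Torus.partialDeriv_convolution (hvi i) hK,
      FunctionSpaces.Torus.partialDeriv_convolution (hχvi i) hK]
    ring
  unfold FunctionSpaces.Torus.divergence
  simp_rw [hderiv]
  rw [Finset.sum_add_distrib, Finset.sum_add_distrib, sum_convolution_mul_partialDeriv_eq hK hχ hv hdiv,
    ← Finset.mul_sum, sum_convolution_partialDeriv_eq_zero hv hdiv hK, mul_zero, add_zero,
    PiLp.inner_apply]
  congr 1
  refine Finset.sum_congr rfl fun i _ => ?_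
  rw [RCLike.inner_apply, conj_trivial, FunctionSpaces.Torus.gradient_apply hχ1 x i, vecConv_apply]

end Divergence

/-! ## Hölder `3/2, 3` glue on a measure space -/

section Holder

variable {X : Type*} [MeasurableSpace X] {μ : Measure X}

/-- `w W` is integrable for `∫ |w|^{3/2} < ∞`, `∫ |W|³ < ∞` (Hölder `3/2, 3`,
`lintegral_mul_le_L32_mul_L3`). [folklore] -/
theorem integrable_mul_of_lintegral_rpow {w W : X → ℝ} (hw : AEStronglyMeasurable w μ)
    (hW : AEStronglyMeasurable W μ) (hw32 : ∫⁻ x, ‖w x‖ₑ ^ (3 / 2 : ℝ) ∂μ < ⊤)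
    (hW3 : ∫⁻ x, ‖W x‖ₑ ^ (3 : ℝ) ∂μ < ⊤) : Integrable (fun x => w x * W x) μ := by
  refine ⟨hw.mul hW, ?_⟩
  calc ∫⁻ x, ‖w x * W x‖ₑ ∂μ = ∫⁻ x, ‖w x‖ₑ * ‖W x‖ₑ ∂μ := lintegral_congr fun x => enorm_mul _ _
    _ ≤ (∫⁻ x, ‖w x‖ₑ ^ (3 / 2 : ℝ) ∂μ) ^ (2 / 3 : ℝ) * (∫⁻ x, ‖W x‖ₑ ^ (3 : ℝ) ∂μ) ^ (1 / 3 : ℝ) :=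
        lintegral_mul_le_L32_mul_L3 μ hw.enorm hW.enorm
    _ < ⊤ := ENNReal.mul_lt_top (ENNReal.rpow_lt_top_of_nonneg (by norm_num) hw32.ne)
        (ENNReal.rpow_lt_top_of_nonneg (by norm_num) hW3.ne)

/-- **Weighted `L³` convergence gives `L¹` convergence**: if `∫ |w|^{3/2} < ∞` and
`∫ |Wᵢ - W₀|³ → 0` along a filter, then `∫ |w Wᵢ - w W₀| → 0` (Hölder `3/2, 3`). [folklore] -/
theorem tendsto_lintegral_enorm_mul_sub {ι : Type*} {l : Filter ι} {w : X → ℝ} {W : ι → X → ℝ}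
    {W₀ : X → ℝ} (hw : AEStronglyMeasurable w μ)
    (hW : ∀ᶠ i in l, AEStronglyMeasurable (fun x => W i x - W₀ x) μ)
    (hw32 : ∫⁻ x, ‖w x‖ₑ ^ (3 / 2 : ℝ) ∂μ < ⊤)
    (hlim : Tendsto (fun i => ∫⁻ x, ‖W i x - W₀ x‖ₑ ^ (3 : ℝ) ∂μ) l (𝓝 0)) :
    Tendsto (fun i => ∫⁻ x, ‖w x * W i x - w x * W₀ x‖ₑ ∂μ) l (𝓝 0) := by
  have hB : Tendsto (fun i => (∫⁻ x, ‖w x‖ₑ ^ (3 / 2 : ℝ) ∂μ) ^ (2 / 3 : ℝ) *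
      (∫⁻ x, ‖W i x - W₀ x‖ₑ ^ (3 : ℝ) ∂μ) ^ (1 / 3 : ℝ)) l (𝓝 0) := by
    have h1 : Tendsto (fun i => (∫⁻ x, ‖W i x - W₀ x‖ₑ ^ (3 : ℝ) ∂μ) ^ (1 / 3 : ℝ)) l (𝓝 0) := by
      have := ((ENNReal.continuous_rpow_const (y := (1 / 3 : ℝ))).tendsto 0).comp hlim
      rwa [ENNReal.zero_rpow_of_pos (by norm_num)] at this
    have h2 := ENNReal.Tendsto.const_mul h1 (a := (∫⁻ x, ‖w x‖ₑ ^ (3 / 2 : ℝ) ∂μ) ^ (2 / 3 : ℝ))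
      (Or.inr (ENNReal.rpow_ne_top_of_nonneg (by norm_num) hw32.ne))
    rwa [mul_zero] at h2
  refine tendsto_of_tendsto_of_tendsto_of_le_of_le' tendsto_const_nhds hB
    (Eventually.of_forall fun _ => zero_le) ?_
  filter_upwards [hW] with i hi
  calc ∫⁻ x, ‖w x * W i x - w x * W₀ x‖ₑ ∂μ = ∫⁻ x, ‖w x‖ₑ * ‖W i x - W₀ x‖ₑ ∂μ := by
        refine lintegral_congr fun x => ?_
        rw [← mul_sub, enorm_mul]
    _ ≤ _ := lintegral_mul_le_L32_mul_L3 μ hw.enorm hi.enorm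

/-- A pointwise bound `|f| ≤ C |g|` propagates to `∫ |f|^r ≤ C^r ∫ |g|^r` (`r ≥ 0`). [folklore] -/
theorem lintegral_rpow_enorm_le_of_norm_le {E E' : Type*} [NormedAddCommGroup E]
    [NormedAddCommGroup E'] {f : X → E} {g : X → E'} {C : ℝ} (hC : 0 ≤ C)
    (h : ∀ᵐ x ∂μ, ‖f x‖ ≤ C * ‖g x‖) {r : ℝ} (hr : 0 ≤ r) :
    ∫⁻ x, ‖f x‖ₑ ^ r ∂μ ≤ ENNReal.ofReal C ^ r * ∫⁻ x, ‖g x‖ₑ ^ r ∂μ := by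
  rw [← lintegral_const_mul' _ _ (ENNReal.rpow_ne_top_of_nonneg hr ENNReal.ofReal_ne_top)]
  refine lintegral_mono_ae (h.mono fun x hx => ?_)
  rw [← ENNReal.mul_rpow_of_nonneg _ _ hr]
  refine ENNReal.rpow_le_rpow ?_ hr
  rw [← ofReal_norm, ← ofReal_norm, ← ENNReal.ofReal_mul hC]
  exact ENNReal.ofReal_le_ofReal hx

end Holder

/-! ## Discharge of `tendsto_pressure_pairing` -/

section Pressure

omit [Fintype d] [DecidableEq d] in
/-- The bookkeeping behind the pressure limit: with `G = ∑ᵢ aᵢ bᵢ`,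
`P (∑ᵢ aᵢ cᵢ + B) = 2 P G + (∑ᵢ (P aᵢ cᵢ - P aᵢ bᵢ) + (P B - P G))`. [folklore] -/
theorem pressure_pairing_algebra {ι : Type*} [Fintype ι] (P B G : ℝ) (a b c : ι → ℝ)
    (hG : G = ∑ i, a i * b i) :
    P * (∑ i, a i * c i + B) =
      2 * (P * G) + (∑ i, (P * a i * c i - P * a i * b i) + (P * B - P * G)) := by
  have h1 : ∑ i, (P * a i * c i - P * a i * b i) = P * ∑ i, a i * c i - P * G := by
    rw [hG, Finset.mul_sum, Finset.mul_sum, ← Finset.sum_sub_distrib]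
    exact Finset.sum_congr rfl fun i _ => by ring
  rw [h1]
  ring

/-- **Discharge of `Torus.tendsto_pressure_pairing`** (Duchon–Robert 2000, proof of Prop. 1,
p. 251: `div(½(u p^ε + u^ε p)) → div(u p)` in `𝒟'`; Evans, App. C.4, Thm. 7 (iv)). For
`u ∈ L³((0,T) × T^d)` jointly measurable and weakly divergence free at a.e. time,
`p ∈ L^{3/2}((0,T) × T^d)`, a mollifier `φ` with torus kernels `K_ε` and a test function `ψ`
supported in `(0,T)`: `∫₀ᵀ∫ p div Φ_ε → 2 ∫₀ᵀ∫ p ⟪u, ∇ψ⟫` as `ε → 0⁺`, where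
`Φ_ε = ψ u^{K_ε} + (ψ u) ⋆ K_ε`. Proof: at a.e. time `div Φ_ε = ⟪u ⋆ K_ε, ∇ψ⟫ + ⟪u, ∇ψ⟫ ⋆ K_ε`
(`divergence_symmTestField`), so that on `(0,T) × T^d`
`p div Φ_ε - 2 p ⟪u, ∇ψ⟫ = ∑ᵢ p ∂ᵢψ (uᵢ ⋆ K_ε - uᵢ) + p (⟪u, ∇ψ⟫ ⋆ K_ε - ⟪u, ∇ψ⟫)`; each
bracket tends to `0` in `L³((0,T) × T^d)` (`Torus.tendsto_lintegral_prod_rpow_enorm_convolution_sub_self`,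
the kernels `K_ε` forming an approximate identity along `𝓝[>] 0`), the weights `p ∂ᵢψ`, `p`
are in `L^{3/2}`, and Hölder `3/2, 3` gives convergence in `L¹((0,T) × T^d)`, hence of the
iterated integrals (Fubini). [cite: Evans2010, App. C.4 Thm. 7 (iv)] -/
theorem tendsto_pressure_pairing_holds : tendsto_pressure_pairing (d := d) := by
  intro T u p hmeas hu3 hdiv hpmeas hp φ hφ ψ hψ
  set μT := (volume.restrict (Ioo 0 T)).prod (volume : Measure (UnitAddTorus d)) with hμT
  -- measurability in product form
  have hum : AEStronglyMeasurable (uncurry u) μT := aestronglyMeasurable_uncurry_prod hmeas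
  have hpm : AEStronglyMeasurable (uncurry p) μT := aestronglyMeasurable_uncurry_prod hpmeas
  -- the test field: smooth slices, bounded measurable gradient
  have hψs : ∀ t, FunctionSpaces.Torus.IsSmooth (ψ t) := fun t => hψ.isSpaceTimeTest.isSmooth_slice t
  obtain ⟨-, -, hgr, -⟩ := hψ.isSpaceTimeTest.isSmoothSpaceTimeOn_derived
  obtain ⟨⟨C, hC0, hC⟩, hgrm⟩ := hgr.bound_and_measurable T
  -- the kernels `K_ε` form an approximate identity along `ε → 0⁺`
  have hk := eventually_mollifierKernel hφ
  have hks : ∀ δ > 0, ∀ᶠ ε in 𝓝[>] (0 : ℝ), support (mollifierKernel φ ε) ⊆ ball 0 δ :=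
    fun δ hδ => eventually_support_mollifierKernel_subset hφ hδ
  -- a.e. `z ∈ (0,T) × T^d`: the time lies in `(0,T)`
  have hIoo : ∀ᵐ z ∂μT, z.1 ∈ Ioo 0 T := by
    rw [hμT, ← volume_restrict_Ioo_prod_univ]
    filter_upwards [ae_restrict_mem (measurableSet_Ioo.prod MeasurableSet.univ)] with z hz
    exact hz.1
  have hgrb : ∀ᵐ z ∂μT, ‖FunctionSpaces.Torus.gradient (ψ z.1) z.2‖ ≤ C :=
    hIoo.mono fun z hz => hC z.1 (Ioo_subset_Icc_self hz) z.2
  -- finiteness in product form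
  have hU3 : ∫⁻ z, ‖u z.1 z.2‖ₑ ^ (3 : ℝ) ∂μT < ⊤ := by
    have e : ∫⁻ t in Ioo 0 T, ∫⁻ x, ‖u t x‖ₑ ^ (3 : ℝ) = ∫⁻ z, ‖u z.1 z.2‖ₑ ^ (3 : ℝ) ∂μT :=
      lintegral_Ioo_lintegral_eq_lintegral_prod (hum.enorm.pow_const _)
    rw [← e]
    simpa only [ENNReal.rpow_ofNat] using hu3
  have hP32 : ∫⁻ z, ‖p z.1 z.2‖ₑ ^ (3 / 2 : ℝ) ∂μT < ⊤ := by
    have e : ∫⁻ t in Ioo 0 T, ∫⁻ x, ‖p t x‖ₑ ^ (3 / 2 : ℝ) = ∫⁻ z, ‖p z.1 z.2‖ₑ ^ (3 / 2 : ℝ) ∂μT :=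
      lintegral_Ioo_lintegral_eq_lintegral_prod (hpm.enorm.pow_const _)
    rw [← e]
    exact hp
  -- the scalar fields: components `uᵢ`, `g = ⟪u, ∇ψ⟫`, weights `wᵢ = p ∂ᵢψ`
  set ui : d → ℝ → UnitAddTorus d → ℝ := fun i t x => u t x i with hui
  set g : ℝ → UnitAddTorus d → ℝ := fun t x => ⟪u t x, FunctionSpaces.Torus.gradient (ψ t) x⟫ with hg
  set w : d → ℝ × UnitAddTorus d → ℝ := fun i z =>
    p z.1 z.2 * FunctionSpaces.Torus.gradient (ψ z.1) z.2 i with hw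
  have hui_m : ∀ i, AEStronglyMeasurable (uncurry (ui i)) μT := fun i =>
    aestronglyMeasurable_uncurry_apply hum i
  have hg_m : AEStronglyMeasurable (uncurry g) μT := hum.inner hgrm
  have hgri_m : ∀ i, AEStronglyMeasurable
      (uncurry fun t x => FunctionSpaces.Torus.gradient (ψ t) x i) μT := fun i =>
    aestronglyMeasurable_uncurry_apply hgrm i
  have hw_m : ∀ i, AEStronglyMeasurable (w i) μT := fun i => hpm.mul (hgri_m i)
  have hui_3 : ∀ i, ∫⁻ z, ‖ui i z.1 z.2‖ₑ ^ (3 : ℝ) ∂μT < ⊤ := by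
    intro i
    refine lt_of_le_of_lt ?_ hU3
    refine lintegral_mono fun z => ENNReal.rpow_le_rpow ?_ (by norm_num)
    rw [← ofReal_norm, ← ofReal_norm]
    exact ENNReal.ofReal_le_ofReal (PiLp.norm_apply_le (u z.1 z.2) i)
  have hg_3 : ∫⁻ z, ‖g z.1 z.2‖ₑ ^ (3 : ℝ) ∂μT < ⊤ := by
    have hb : ∀ᵐ z ∂μT, ‖g z.1 z.2‖ ≤ C * ‖u z.1 z.2‖ := hgrb.mono fun z hz => by
      rw [hg]
      calc ‖⟪u z.1 z.2, FunctionSpaces.Torus.gradient (ψ z.1) z.2⟫‖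
          ≤ ‖u z.1 z.2‖ * ‖FunctionSpaces.Torus.gradient (ψ z.1) z.2‖ := norm_inner_le_norm _ _
        _ ≤ ‖u z.1 z.2‖ * C := mul_le_mul_of_nonneg_left hz (norm_nonneg _)
        _ = C * ‖u z.1 z.2‖ := mul_comm _ _
    refine lt_of_le_of_lt (lintegral_rpow_enorm_le_of_norm_le hC0 hb (by norm_num)) ?_
    exact ENNReal.mul_lt_top (ENNReal.rpow_lt_top_of_nonneg (by norm_num) ENNReal.ofReal_ne_top) hU3
  have hw_32 : ∀ i, ∫⁻ z, ‖w i z‖ₑ ^ (3 / 2 : ℝ) ∂μT < ⊤ := by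
    intro i
    have hb : ∀ᵐ z ∂μT, ‖w i z‖ ≤ C * ‖p z.1 z.2‖ := hgrb.mono fun z hz => by
      rw [hw, norm_mul]
      calc ‖p z.1 z.2‖ * ‖FunctionSpaces.Torus.gradient (ψ z.1) z.2 i‖
          ≤ ‖p z.1 z.2‖ * C := mul_le_mul_of_nonneg_left
            ((PiLp.norm_apply_le (FunctionSpaces.Torus.gradient (ψ z.1) z.2) i).trans hz) (norm_nonneg _)
        _ = C * ‖p z.1 z.2‖ := mul_comm _ _
    refine lt_of_le_of_lt (lintegral_rpow_enorm_le_of_norm_le hC0 hb (by norm_num)) ?_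
    exact ENNReal.mul_lt_top (ENNReal.rpow_lt_top_of_nonneg (by norm_num) ENNReal.ofReal_ne_top) hP32
  -- `L³` convergence of the space-mollified fields on `(0,T) × T^d`
  have h13 : (1 : ℝ) ≤ 3 := by norm_num
  have hLi : ∀ i, Tendsto (fun ε => ∫⁻ z, ‖(ui i z.1 ⋆ mollifierKernel φ ε) z.2 - ui i z.1 z.2‖ₑ ^ (3 : ℝ) ∂μT)
      (𝓝[>] 0) (𝓝 0) := fun i =>
    FunctionSpaces.Torus.tendsto_lintegral_prod_rpow_enorm_convolution_sub_self hk hks (hui_m i) h13 (hui_3 i)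
  have hLg : Tendsto (fun ε => ∫⁻ z, ‖(g z.1 ⋆ mollifierKernel φ ε) z.2 - g z.1 z.2‖ₑ ^ (3 : ℝ) ∂μT)
      (𝓝[>] 0) (𝓝 0) :=
    FunctionSpaces.Torus.tendsto_lintegral_prod_rpow_enorm_convolution_sub_self hk hks hg_m h13 hg_3
  -- measurability of the mollified fields, eventually
  have hconv_m : ∀ᶠ ε in 𝓝[>] (0 : ℝ),
      (∀ i, AEStronglyMeasurable (uncurry fun t x => (ui i t ⋆ mollifierKernel φ ε) x) μT) ∧
        AEStronglyMeasurable (uncurry fun t x => (g t ⋆ mollifierKernel φ ε) x) μT := by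
    filter_upwards [hk] with ε hε
    exact ⟨fun i => FunctionSpaces.Torus.aestronglyMeasurable_uncurry_convolution _ (hui_m i) hε.2.2,
      FunctionSpaces.Torus.aestronglyMeasurable_uncurry_convolution _ hg_m hε.2.2⟩
  -- `L¹` convergence of the weighted terms
  have hTi : ∀ i, Tendsto (fun ε => ∫⁻ z, ‖w i z * (ui i z.1 ⋆ mollifierKernel φ ε) z.2 -
      w i z * ui i z.1 z.2‖ₑ ∂μT) (𝓝[>] 0) (𝓝 0) := fun i =>
    tendsto_lintegral_enorm_mul_sub (hw_m i)
      (hconv_m.mono fun ε hε => ((hε.1 i).sub (hui_m i) :)) (hw_32 i) (hLi i)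
  have hTg : Tendsto (fun ε => ∫⁻ z, ‖p z.1 z.2 * (g z.1 ⋆ mollifierKernel φ ε) z.2 -
      p z.1 z.2 * g z.1 z.2‖ₑ ∂μT) (𝓝[>] 0) (𝓝 0) :=
    tendsto_lintegral_enorm_mul_sub hpm (hconv_m.mono fun ε hε => (hε.2.sub hg_m :)) hP32 hLg
  -- the integrands on the product space
  set F : ℝ → ℝ × UnitAddTorus d → ℝ := fun ε z => p z.1 z.2 *
    FunctionSpaces.Torus.divergence (symmTestField (mollifierKernel φ ε) (ψ z.1) (u z.1)) z.2 with hF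
  set f : ℝ × UnitAddTorus d → ℝ := fun z => 2 * (p z.1 z.2 * g z.1 z.2) with hf
  set R : ℝ → ℝ × UnitAddTorus d → ℝ := fun ε z =>
    (∑ i, (w i z * (ui i z.1 ⋆ mollifierKernel φ ε) z.2 - w i z * ui i z.1 z.2)) +
      (p z.1 z.2 * (g z.1 ⋆ mollifierKernel φ ε) z.2 - p z.1 z.2 * g z.1 z.2) with hR
  -- a.e. slices: integrable and weakly divergence free
  have hslice1 : ∀ᵐ t ∂(volume.restrict (Ioo 0 T)), Integrable (u t) volume := by
    have h3 := FunctionSpaces.Torus.ae_memLp_of_lintegral_prod_rpow_lt_top hum (by norm_num : (0:ℝ) < 3) hU3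
    filter_upwards [h3] with t ht
    exact ht.integrable (by rw [← ENNReal.ofReal_one]; exact ENNReal.ofReal_le_ofReal (by norm_num))
  have hgood : ∀ᵐ z ∂μT, Integrable (u z.1) volume ∧ FunctionSpaces.Torus.IsWeaklyDivFree (u z.1) :=
    (Measure.quasiMeasurePreserving_fst (μ := volume.restrict (Ioo 0 T))
      (ν := (volume : Measure (UnitAddTorus d)))).ae (hslice1.and hdiv)
  -- the identity `F ε = f + R ε` a.e., for `ε > 0`
  have hFR : ∀ᶠ ε in 𝓝[>] (0 : ℝ), ∀ᵐ z ∂μT, F ε z = f z + R ε z := by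
    filter_upwards [self_mem_nhdsWithin] with ε hε
    filter_upwards [hgood] with z hz
    have hK := isSmooth_mollifierKernel hφ hε
    rw [hF, hf, hR]
    dsimp only
    rw [divergence_symmTestField hK (hψs z.1) hz.1 hz.2 z.2]
    exact pressure_pairing_algebra (p z.1 z.2) _ _ (fun i => FunctionSpaces.Torus.gradient (ψ z.1) z.2 i)
      (fun i => u z.1 z.2 i) (fun i => (ui i z.1 ⋆ mollifierKernel φ ε) z.2)
      (PiLp.inner_apply (u z.1 z.2) (FunctionSpaces.Torus.gradient (ψ z.1) z.2))
  -- integrability of `f` and of `R ε` (eventually)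
  have hI0 : ∀ i, Integrable (fun z => w i z * ui i z.1 z.2) μT := fun i =>
    integrable_mul_of_lintegral_rpow (hw_m i) (hui_m i) (hw_32 i) (hui_3 i)
  have hIg : Integrable (fun z => p z.1 z.2 * g z.1 z.2) μT :=
    integrable_mul_of_lintegral_rpow hpm hg_m hP32 hg_3
  have hIf : Integrable f μT := hIg.const_mul 2
  have hconv_3 : ∀ᶠ ε in 𝓝[>] (0 : ℝ),
      (∀ i, ∫⁻ z, ‖(ui i z.1 ⋆ mollifierKernel φ ε) z.2‖ₑ ^ (3 : ℝ) ∂μT < ⊤) ∧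
        ∫⁻ z, ‖(g z.1 ⋆ mollifierKernel φ ε) z.2‖ₑ ^ (3 : ℝ) ∂μT < ⊤ := by
    filter_upwards [hk] with ε hε
    exact ⟨fun i => lt_of_le_of_lt (FunctionSpaces.Torus.lintegral_prod_rpow_enorm_convolution_le
        (hui_m i) hε.2.2 hε.1 hε.2.1 h13) (hui_3 i),
      lt_of_le_of_lt (FunctionSpaces.Torus.lintegral_prod_rpow_enorm_convolution_le
        hg_m hε.2.2 hε.1 hε.2.1 h13) hg_3⟩
  have hIR : ∀ᶠ ε in 𝓝[>] (0 : ℝ), Integrable (R ε) μT := by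
    filter_upwards [hconv_m, hconv_3] with ε hm3 h3
    refine (integrable_finsetSum _ fun i _ => ?_).add ?_
    · exact (integrable_mul_of_lintegral_rpow (hw_m i) (hm3.1 i) (hw_32 i) (h3.1 i)).sub (hI0 i)
    · exact (integrable_mul_of_lintegral_rpow hpm hm3.2 hP32 h3.2).sub hIg
  have hIF : ∀ᶠ ε in 𝓝[>] (0 : ℝ), Integrable (F ε) μT := by
    filter_upwards [hFR, hIR] with ε hFRε hIRε
    exact (hIf.add hIRε).congr (hFRε.mono fun z hz => hz.symm)
  -- the `L¹` distance tends to zero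
  have hdist : Tendsto (fun ε => ∫⁻ z, ‖F ε z - f z‖ₑ ∂μT) (𝓝[>] 0) (𝓝 0) := by
    have hsum : Tendsto (fun ε =>
        (∑ i, ∫⁻ z, ‖w i z * (ui i z.1 ⋆ mollifierKernel φ ε) z.2 - w i z * ui i z.1 z.2‖ₑ ∂μT) +
          ∫⁻ z, ‖p z.1 z.2 * (g z.1 ⋆ mollifierKernel φ ε) z.2 - p z.1 z.2 * g z.1 z.2‖ₑ ∂μT)
        (𝓝[>] 0) (𝓝 0) := by
      have := (tendsto_finsetSum (Finset.univ) fun i _ => hTi i).add hTg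
      simpa using this
    refine tendsto_of_tendsto_of_tendsto_of_le_of_le' tendsto_const_nhds hsum
      (Eventually.of_forall fun _ => zero_le) ?_
    filter_upwards [hFR, hconv_m] with ε hFRε hm
    have e : ∫⁻ z, ‖F ε z - f z‖ₑ ∂μT = ∫⁻ z, ‖R ε z‖ₑ ∂μT :=
      lintegral_congr_ae (hFRε.mono fun z hz => by
        show ‖F ε z - f z‖ₑ = ‖R ε z‖ₑ
        rw [hz, add_sub_cancel_left])
    rw [e]
    have hmi : ∀ i, AEMeasurable (fun z =>
        ‖w i z * (ui i z.1 ⋆ mollifierKernel φ ε) z.2 - w i z * ui i z.1 z.2‖ₑ) μT := fun i =>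
      (((hw_m i).mul (hm.1 i)).sub ((hw_m i).mul (hui_m i))).enorm
    calc ∫⁻ z, ‖R ε z‖ₑ ∂μT
        ≤ ∫⁻ z, (∑ i, ‖w i z * (ui i z.1 ⋆ mollifierKernel φ ε) z.2 - w i z * ui i z.1 z.2‖ₑ) +
            ‖p z.1 z.2 * (g z.1 ⋆ mollifierKernel φ ε) z.2 - p z.1 z.2 * g z.1 z.2‖ₑ ∂μT := by
          refine lintegral_mono fun z => ?_
          exact (enorm_add_le _ _).trans (add_le_add (enorm_sum_le _ _) le_rfl)
      _ = (∑ i, ∫⁻ z, ‖w i z * (ui i z.1 ⋆ mollifierKernel φ ε) z.2 - w i z * ui i z.1 z.2‖ₑ ∂μT) +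
            ∫⁻ z, ‖p z.1 z.2 * (g z.1 ⋆ mollifierKernel φ ε) z.2 - p z.1 z.2 * g z.1 z.2‖ₑ ∂μT := by
          rw [lintegral_add_left' (Finset.aemeasurable_fun_sum _ fun i _ => hmi i),
            lintegral_finsetSum' _ fun i _ => hmi i]
  -- conclusion: `∫ F ε → ∫ f` on the product, read as iterated integrals
  have hmain := tendsto_integral_of_L1 f hIf.aestronglyMeasurable hIF hdist
  have eF : ∀ᶠ ε in 𝓝[>] (0 : ℝ), ∫ z, F ε z ∂μT = ∫ t in Ioo 0 T, ∫ x,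
      p t x * FunctionSpaces.Torus.divergence (symmTestField (mollifierKernel φ ε) (ψ t) (u t)) x :=
    hIF.mono fun ε hε => integral_prod _ hε
  have e1 : ∫ z, p z.1 z.2 * g z.1 z.2 ∂μT =
      ∫ t in Ioo 0 T, ∫ x, p t x * ⟪u t x, FunctionSpaces.Torus.gradient (ψ t) x⟫ :=
    integral_prod _ hIg
  have ef : ∫ z, f z ∂μT =
      2 * ∫ t in Ioo 0 T, ∫ x, p t x * ⟪u t x, FunctionSpaces.Torus.gradient (ψ t) x⟫ := by
    rw [← e1, ← integral_const_mul]
  rw [← ef]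
  exact hmain.congr' eF

end Pressure

end Literature.Analysis.FluidPDE.Torus
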